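import Mathlib
import Literature.Geometry.Lorentzian.KerrSchildCoord
import Literature.Geometry.Lorentzian.KerrConvergence
import Summits.FinalStateConjecture.FinalStateConjecture.Theorems.EIHFluxBalanceInertialRecessionLorentz
import Summits.FinalStateConjecture.FinalStateConjecture.Theorems.ClusterCompletenessRecedingDopplerBudgetZones

/-!
# Route ClusterCompleteness — `RecedingDopplerBudget`: Doppler kinematics of one flight

Helper file for the support item `stmt-FinalStateConjecture-15025`
(`Summit.FinalStateConjecture.FinalStateConjecture.Theses.ClusterCompleteness.RecedingDopplerBudget`).

Special-relativistic kinematics of a photon (null covector `ξ`, lab energy `E = −ξ₀ > 0`) against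
the slow inertial holes of the item's configuration (`‖uᵢ~‖ ≤ uᵢ⁰/10`, `uᵢ⁰ ≤ 51/50`):

* at an exactly flat event the hole-frame energy `Eᵢ = −ξ(uᵢ)` is pinched between
  `(9/10) uᵢ⁰ E` and `(11/10) uᵢ⁰ E` (`energy_pairing_bounds`), so any two frame energies at the
  same flat event differ by a factor `≤ 5/4` (`energy_pairing_le_of_flat`);
* **the leg lemma** (`leg_decay`): for a straight null flight from an event `X` of the closed zone
  of hole `i` (lab time `≥ 0`) to an event `A` of the closed zone of hole `j ≠ i`, the identity
  `Eⱼ · (−η(A − X, uᵢ)) = Eᵢ · (−η(A − X, uⱼ))` together with the rest-frame decompositions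
  `X = Oᵢ + τ_X uᵢ + z_X`, `A = Oⱼ + τ_A uⱼ + z_A` gives
  `Eⱼ (γ τ_A + τ_X + c₂) = Eᵢ (τ_A − γ τ_X + c₁)` with `γ = −η(uᵢ, uⱼ) > 1` and bounded `c₁, c₂`,
  whence `Eⱼ ≤ θᵢⱼ Eᵢ` with `θᵢⱼ = (1 + γ)/(2γ) < 1` as soon as the arrival lab time `A⁰` exceeds
  an explicit configuration constant — the Doppler red-shift of recession (Bondi's `k`-calculus;
  O'Neill 1983, Ch. 6, pp. 170–172).
-/

noncomputable section

open Literature.Geometry.Lorentzian Set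
open scoped InnerProductSpace

namespace Summit.FinalStateConjecture.FinalStateConjecture.Theorems.RecedingDoppler

/-- `|η(z, w)| ≤ ‖z‖ ‖w‖` for the Euclidean norms of `E4` (Cauchy–Schwarz, componentwise).
[folklore] -/
theorem abs_minkowski_bilin_le (z w : E4) : |Minkowski.bilin z w| ≤ ‖z‖ * ‖w‖ := by
  rw [minkowski_bilin_eq_inner]
  have h1 : |z 0| ≤ ‖z‖ := by
    have h := norm_sq_eq_sq_add_spatialNorm_sq z
    refine (sq_le_sq₀ (abs_nonneg _) (norm_nonneg z)).mp ?_
    rw [sq_abs]; nlinarith [sq_nonneg (E4.spatialNorm z)]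
  have h2 : |w 0| ≤ ‖w‖ := by
    have h := norm_sq_eq_sq_add_spatialNorm_sq w
    refine (sq_le_sq₀ (abs_nonneg _) (norm_nonneg w)).mp ?_
    rw [sq_abs]; nlinarith [sq_nonneg (E4.spatialNorm w)]
  have h3 : ‖E4.spatial z‖ ≤ ‖z‖ := by
    have h := norm_sq_eq_sq_add_spatialNorm_sq z
    rw [E4.spatialNorm] at h
    refine (sq_le_sq₀ (norm_nonneg _) (norm_nonneg z)).mp ?_
    nlinarith [sq_nonneg (z 0)]
  have h4 : ‖E4.spatial w‖ ≤ ‖w‖ := by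
    have h := norm_sq_eq_sq_add_spatialNorm_sq w
    rw [E4.spatialNorm] at h
    refine (sq_le_sq₀ (norm_nonneg _) (norm_nonneg w)).mp ?_
    nlinarith [sq_nonneg (w 0)]
  have h5 : |⟪E4.spatial z, E4.spatial w⟫_ℝ| ≤ ‖E4.spatial z‖ * ‖E4.spatial w‖ :=
    abs_real_inner_le_norm _ _
  have hz0 := norm_sq_eq_sq_add_spatialNorm_sq z
  have hw0 := norm_sq_eq_sq_add_spatialNorm_sq w
  rw [E4.spatialNorm] at hz0 hw0
  -- `|−ab + c| ≤ |a||b| + |c| ≤ ‖z‖‖w‖` by Cauchy–Schwarz in `ℝ²` for `(|z⁰|, ‖z~‖)·(|w⁰|, ‖w~‖)`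
  have hcs : |z 0| * |w 0| + ‖E4.spatial z‖ * ‖E4.spatial w‖ ≤ ‖z‖ * ‖w‖ := by
    have ha := abs_nonneg (z 0)
    have hb := abs_nonneg (w 0)
    have hc := norm_nonneg (E4.spatial z)
    have hd := norm_nonneg (E4.spatial w)
    have hsq : (|z 0| * |w 0| + ‖E4.spatial z‖ * ‖E4.spatial w‖) ^ 2 ≤ (‖z‖ * ‖w‖) ^ 2 := by
      rw [mul_pow, hz0, hw0, ← sq_abs (z 0), ← sq_abs (w 0)]
      nlinarith [sq_nonneg (|z 0| * ‖E4.spatial w‖ - ‖E4.spatial z‖ * |w 0|),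
        mul_nonneg ha hb, mul_nonneg hc hd]
    exact (sq_le_sq₀ (by positivity) (by positivity)).mp hsq
  calc |-(z 0 * w 0) + ⟪E4.spatial z, E4.spatial w⟫_ℝ|
      ≤ |-(z 0 * w 0)| + |⟪E4.spatial z, E4.spatial w⟫_ℝ| := abs_add_le _ _
    _ ≤ |z 0| * |w 0| + ‖E4.spatial z‖ * ‖E4.spatial w‖ := by
        rw [abs_neg, abs_mul]; exact add_le_add le_rfl h5
    _ ≤ ‖z‖ * ‖w‖ := hcs

/-- The Euclidean pairing `∑_μ ξ_μ u^μ = ξ₀ u⁰ + ⟪ξ~, u~⟫`. [folklore] -/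
theorem sum_mul_eq_inner (ξ w : E4) : ∑ μ, ξ μ * w μ = ξ 0 * w 0 + ⟪E4.spatial ξ, E4.spatial w⟫_ℝ := by
  have h := minkowski_bilin_eq_inner ξ w
  rw [Minkowski.bilin_apply] at h
  rw [Fin.sum_univ_succ]
  linarith

/-- **The velocity of a flat flight pairs like the momentum**: if `V^μ = ∑_ν η^{μν} ζ_ν` then
`η(V, w) = ∑_μ ζ_μ w^μ` (raising the index with `η`). [folklore] -/
theorem minkowski_bilin_velocity_flat {V ζ : E4}
    (hV : ∀ μ, V μ = ∑ ν, Minkowski.bilin (E4.basisVector μ) (E4.basisVector ν) * ζ ν) (w : E4) :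
    Minkowski.bilin V w = ∑ μ, ζ μ * w μ := by
  have h0 : V 0 = -(ζ 0) := by
    rw [hV]
    simp only [Kerr.minkowski_bilin_basisVector, Kerr.etaComp, Fin.sum_univ_four]
    simp
  have hs : ∀ k : Fin 3, V k.succ = ζ k.succ := by
    intro k
    rw [hV]
    simp only [Kerr.minkowski_bilin_basisVector, Kerr.etaComp, Fin.sum_univ_four]
    fin_cases k <;> simp
  rw [Minkowski.bilin_apply, Fin.sum_univ_succ (f := fun μ ↦ ζ μ * w μ), h0]
  simp only [hs]
  ring

/-- **Frame energies at a flat event are pinched by the lab energy**: for an `η`-null covector `ξ`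
with `E = −ξ₀ > 0` and a slow 4-velocity `u = Λe₀` (`‖u~‖ ≤ u⁰/10`),
`(9/10) u⁰ E ≤ −ξ(u) ≤ (11/10) u⁰ E` (`−ξ(u) = u⁰E − ⟪ξ~, u~⟫`, `‖ξ~‖ = E`; the aberration /
Doppler bounds `γ(1 ∓ v)E`, O'Neill 1983, Ch. 6, p. 171). [folklore] -/
theorem energy_pairing_bounds {uk : E4}
    (hv : 0 < uk 0 ∧ ‖E4.spatial uk‖ ≤ 1 / 10 * uk 0) {ξ : E4}
    (hnull : Minkowski.bilin ξ ξ = 0) (hE : 0 < -(ξ 0)) :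
    9 / 10 * uk 0 * (-(ξ 0)) ≤ -(∑ μ, ξ μ * uk μ) ∧
      -(∑ μ, ξ μ * uk μ) ≤ 11 / 10 * uk 0 * (-(ξ 0)) := by
  rw [sum_mul_eq_inner]
  have hn : ‖E4.spatial ξ‖ = -(ξ 0) := by
    rw [minkowski_bilin_eq_inner, real_inner_self_eq_norm_sq] at hnull
    have h1 : ‖E4.spatial ξ‖ ^ 2 = (-(ξ 0)) ^ 2 := by nlinarith
    exact (sq_eq_sq₀ (norm_nonneg _) hE.le).mp h1
  have hcs : |⟪E4.spatial ξ, E4.spatial uk⟫_ℝ| ≤ ‖E4.spatial ξ‖ * ‖E4.spatial uk‖ :=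
    abs_real_inner_le_norm _ _
  rw [hn] at hcs
  have h2 : -(ξ 0) * ‖E4.spatial uk‖ ≤ -(ξ 0) * (1 / 10 * uk 0) :=
    mul_le_mul_of_nonneg_left hv.2 hE.le
  have h3 := (abs_le.mp (hcs.trans h2))
  constructor <;> nlinarith [h3.1, h3.2, hv.1]

/-- **Two frame energies at the same flat event differ by at most `5/4`**: with both 4-velocities
slow (`u⁰ ∈ [1, 51/50]`), `−ξ(uⱼ) ≤ (5/4)(−ξ(uᵢ))`. [folklore] -/
theorem energy_pairing_le_of_flat (Λi Λj : lorentzGroup) {ui uj : E4}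
    (hui : ui = (Λi : E4 ≃L[ℝ] E4) (E4.basisVector 0))
    (huj : uj = (Λj : E4 ≃L[ℝ] E4) (E4.basisVector 0))
    (hvi : 0 < ui 0 ∧ ‖E4.spatial ui‖ ≤ 1 / 10 * ui 0)
    (hvj : 0 < uj 0 ∧ ‖E4.spatial uj‖ ≤ 1 / 10 * uj 0) {ξ : E4}
    (hnull : Minkowski.bilin ξ ξ = 0) (hE : 0 < -(ξ 0)) :
    -(∑ μ, ξ μ * uj μ) ≤ 5 / 4 * -(∑ μ, ξ μ * ui μ) := by
  have hi := (energy_pairing_bounds hvi hnull hE).1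
  have hj := (energy_pairing_bounds hvj hnull hE).2
  have h1 := one_le_u_zero Λi hui hvi.1
  have h2 := u_zero_le Λj huj hvj
  nlinarith

/-- Frame energy versus lab energy at a flat event: `−ξ(u) ≤ (6/5) E` and `E ≤ (10/9)(−ξ(u))`.
[folklore] -/
theorem energy_pairing_le_lab (Λk : lorentzGroup) {uk : E4}
    (hu : uk = (Λk : E4 ≃L[ℝ] E4) (E4.basisVector 0))
    (hv : 0 < uk 0 ∧ ‖E4.spatial uk‖ ≤ 1 / 10 * uk 0) {ξ : E4}
    (hnull : Minkowski.bilin ξ ξ = 0) (hE : 0 < -(ξ 0)) :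
    -(∑ μ, ξ μ * uk μ) ≤ 6 / 5 * (-(ξ 0)) ∧ -(ξ 0) ≤ 10 / 9 * -(∑ μ, ξ μ * uk μ) := by
  obtain ⟨hlo, hhi⟩ := energy_pairing_bounds hv hnull hE
  have h1 := one_le_u_zero Λk hu hv.1
  have h2 := u_zero_le Λk hu hv
  constructor <;> nlinarith

/-! ### The leg lemma: Doppler red-shift of one flight between receding zones -/

section Leg

variable {N : ℕ} {M a : Fin N → ℝ} {Λ : Fin N → lorentzGroup} {p : Fin N → E3} {u : Fin N → E4}
  {q : Fin N → E4 → E4}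

/-- `η(Λ y~, Λ e₀) = 0`: the boosted image of a rest-frame spatial vector is `η`-orthogonal to the
4-velocity `u = Λ e₀`. [folklore] -/
theorem minkowski_lorentz_spatialPart_u (Λk : lorentzGroup) {uk : E4}
    (hu : uk = (Λk : E4 ≃L[ℝ] E4) (E4.basisVector 0)) (y : E4) :
    Minkowski.bilin ((Λk : E4 ≃L[ℝ] E4) (y - y 0 • E4.basisVector 0)) uk = 0 := by
  rw [hu, Λk.2, Minkowski.bilin_apply]
  simp [Fin.succ_ne_zero]

/-- `‖(0, pᵢ) − (0, pⱼ)‖ = dist(pᵢ, pⱼ)`. [folklore] -/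
theorem norm_ofTimeSpace_sub (pi pj : E3) :
    ‖E4.ofTimeSpace 0 pi - E4.ofTimeSpace 0 pj‖ = dist pi pj := by
  have h0 : (E4.ofTimeSpace 0 pi - E4.ofTimeSpace 0 pj) 0 = 0 := by simp
  rw [norm_eq_spatialNorm_of_apply_zero_eq_zero h0, E4.spatialNorm, map_sub,
    E4.spatial_ofTimeSpace, E4.spatial_ofTimeSpace, dist_eq_norm]

/-- Real-arithmetic core of the leg lemma: with `22K ≤ (γ − 1)τ_A`, `τ_X ≥ −85Mᵢ`,
`255Mᵢ ≤ K`, `|c₁|, |c₂| ≤ K` and `1 < γ ≤ 4`,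
`2γ(τ_A − γτ_X + c₁) ≤ (1 + γ)(γτ_A − τ_X + c₂)` — the difference is
`γ(γ − 1)τ_A + (γ − 1)(2γ + 1)τ_X + (1 + γ)c₂ − 2γc₁ ≥ 22K − 9K − 5K − 8K`. [folklore] -/
theorem leg_core {γ τA τX c1 c2 K Mi : ℝ} (hγ : 1 < γ) (hγ4 : γ ≤ 4) (hK : 0 < K)
    (h255 : 255 * Mi ≤ K) (hc1 : |c1| ≤ K) (hc2 : |c2| ≤ K)
    (hτX : -(85 * Mi) ≤ τX) (h : 22 * K ≤ (γ - 1) * τA) :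
    2 * γ * (τA - γ * τX + c1) ≤ (1 + γ) * (γ * τA - τX + c2) := by
  have hc1' := abs_le.mp hc1
  have hc2' := abs_le.mp hc2
  have e : (1 + γ) * (γ * τA - τX + c2) - 2 * γ * (τA - γ * τX + c1) =
      γ * ((γ - 1) * τA) + (γ - 1) * (2 * γ + 1) * τX + ((1 + γ) * c2 - 2 * γ * c1) := by ring
  have h1 : γ * (22 * K) ≤ γ * ((γ - 1) * τA) := mul_le_mul_of_nonneg_left h (by linarith)
  have hcoef0 : 0 ≤ (γ - 1) * (2 * γ + 1) := mul_nonneg (by linarith) (by linarith)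
  have hcoef : (γ - 1) * (2 * γ + 1) ≤ 27 := by nlinarith
  have h2 : -(9 * K) ≤ (γ - 1) * (2 * γ + 1) * τX := by
    by_cases hτ : 0 ≤ τX
    · have : 0 ≤ (γ - 1) * (2 * γ + 1) * τX := mul_nonneg hcoef0 hτ
      linarith
    · push Not at hτ
      have : 27 * τX ≤ (γ - 1) * (2 * γ + 1) * τX := mul_le_mul_of_nonpos_right hcoef hτ.le
      linarith
  have h3 : -(5 * K) ≤ (1 + γ) * c2 := by nlinarith [hc2'.1, hc2'.2]
  have h4 : 2 * γ * c1 ≤ 8 * K := by nlinarith [hc1'.1, hc1'.2]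
  nlinarith [h1, h2, h3, h4, e]

/-- Expansion of `η` on the flight combination `O + τ_A uⱼ − τ_X uᵢ + (z_A − z_X)`. [folklore] -/
theorem minkowski_bilin_combo (O uj ui zA zX w : E4) (τA τX : ℝ) :
    Minkowski.bilin (O + τA • uj - τX • ui + (zA - zX)) w =
      Minkowski.bilin O w + τA * Minkowski.bilin uj w - τX * Minkowski.bilin ui w +
        (Minkowski.bilin zA w - Minkowski.bilin zX w) := by
  simp only [map_add, map_sub, map_smul, add_apply, sub_apply, smul_apply, smul_eq_mul]

/-- **The leg lemma (Doppler red-shift of recession).** Let `X` lie in the closed zone of hole `i`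
at a lab time `X⁰ ≥ 0` and `A` in the closed zone of hole `j ≠ i`, and let the two frame energies
`Eᵢ > 0`, `Eⱼ` of a photon be read off the flight vector, `−η(A − X, uᵢ) = λEᵢ`,
`−η(A − X, uⱼ) = λEⱼ` with `λ > 0` (straight null flight from `X` to `A` with constant momentum).
With `γ = −η(uⱼ, uᵢ)` (`> 1`) and `K = 2 dist(pᵢ,pⱼ) + 510(Mᵢ + Mⱼ)`: if the arrival lab time
satisfies `A⁰ ≥ (51/50)(22K/(γ − 1)) + 85Mⱼ`, then `Eⱼ ≤ ((1 + γ)/(2γ)) Eᵢ`. Mechanism: the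
rest-frame decompositions `X = Oᵢ + τ_X uᵢ + z_X`, `A = Oⱼ + τ_A uⱼ + z_A` give
`λEᵢ = γτ_A − τ_X + c₂`, `λEⱼ = τ_A − γτ_X + c₁` with `|c₁|, |c₂| ≤ K`, and
`(τ_A − γτ_X)/(γτ_A − τ_X) ≤ 1/γ` for `τ_X ≥ 0` (Bondi's `k`-calculus with finite-size
corrections; O'Neill 1983, Ch. 6, pp. 170–172). [folklore] -/
theorem leg_decay (hM : ∀ i, 0 < M i) (ha : ∀ i, |a i| ≤ 1 / 10 * M i)
    (hu : ∀ i, u i = (Λ i : E4 ≃L[ℝ] E4) (E4.basisVector 0))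
    (hv : ∀ i, 0 < u i 0 ∧ ‖E4.spatial (u i)‖ ≤ 1 / 10 * u i 0)
    (hq : ∀ i x, q i x = poincareInv (Λ i) (E4.ofTimeSpace 0 (p i)) x)
    {i j : Fin N} (hγ : 1 < -Minkowski.bilin (u j) (u i)) {X A : E4} (hX0 : 0 ≤ X 0)
    (hXi : Kerr.radius (a i) (q i X) ≤ 16 * M i) (hAj : Kerr.radius (a j) (q j A) ≤ 16 * M j)
    {lam Ei Ej : ℝ} (hlam : 0 < lam) (hEi : 0 < Ei)
    (hki : -Minkowski.bilin (A - X) (u i) = lam * Ei)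
    (hkj : -Minkowski.bilin (A - X) (u j) = lam * Ej)
    (hT : 51 / 50 * (22 * (2 * dist (p i) (p j) + 510 * (M i + M j)) /
      (-Minkowski.bilin (u j) (u i) - 1)) + 85 * M j ≤ A 0) :
    Ej ≤ (1 + -Minkowski.bilin (u j) (u i)) / (2 * -Minkowski.bilin (u j) (u i)) * Ei := by
  -- abbreviations
  set γ := -Minkowski.bilin (u j) (u i) with hγdef
  set K := 2 * dist (p i) (p j) + 510 * (M i + M j) with hK
  have hMi := hM i
  have hMj := hM j
  have hKpos : 0 < K := by rw [hK]; positivity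
  -- decompositions
  obtain ⟨hX0eq, hzX0, hzXn⟩ := restTime_bounds (Λ i) (p i) (hM i) (ha i) (hu i) (hv i) (hq i) hXi
  obtain ⟨hA0eq, hzA0, hzAn⟩ := restTime_bounds (Λ j) (p j) (hM j) (ha j) (hu j) (hv j) (hq j) hAj
  set τX := (q i X) 0 with hτX
  set τA := (q j A) 0 with hτA
  set zX : E4 := (Λ i : E4 ≃L[ℝ] E4) (q i X - (q i X) 0 • E4.basisVector 0) with hzX
  set zA : E4 := (Λ j : E4 ≃L[ℝ] E4) (q j A - (q j A) 0 • E4.basisVector 0) with hzA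
  have hdX := eq_decomp (Λ i) (p i) (hu i) (hq i) X
  have hdA := eq_decomp (Λ j) (p j) (hu j) (hq j) A
  rw [← hzX] at hdX
  rw [← hzA] at hdA
  -- `A − X` as a combination
  set O : E4 := E4.ofTimeSpace 0 (p j) - E4.ofTimeSpace 0 (p i) with hO
  have hΔ : A - X = O + τA • u j - τX • u i + (zA - zX) := by
    conv_lhs => rw [hdA, hdX]
    rw [hO]
    abel
  -- pairings
  have huu_i : Minkowski.bilin (u i) (u i) = -1 := minkowski_u_u (Λ i) (hu i)
  have huu_j : Minkowski.bilin (u j) (u j) = -1 := minkowski_u_u (Λ j) (hu j)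
  have hij_sym : Minkowski.bilin (u i) (u j) = -γ := by rw [Minkowski.bilin_symm, hγdef]; ring
  have hji : Minkowski.bilin (u j) (u i) = -γ := by rw [hγdef]; ring
  have hzXu : Minkowski.bilin zX (u i) = 0 := minkowski_lorentz_spatialPart_u (Λ i) (hu i) _
  have hzAu : Minkowski.bilin zA (u j) = 0 := minkowski_lorentz_spatialPart_u (Λ j) (hu j) _
  have hR2 : -Minkowski.bilin (A - X) (u i) =
      γ * τA - τX + (-Minkowski.bilin O (u i) - Minkowski.bilin zA (u i)) := by
    rw [hΔ, minkowski_bilin_combo, huu_i, hzXu, hji]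
    ring
  have hR1 : -Minkowski.bilin (A - X) (u j) =
      τA - γ * τX + (-Minkowski.bilin O (u j) + Minkowski.bilin zX (u j)) := by
    rw [hΔ, minkowski_bilin_combo, huu_j, hzAu, hij_sym]
    ring
  set c2 := -Minkowski.bilin O (u i) - Minkowski.bilin zA (u i) with hc2
  set c1 := -Minkowski.bilin O (u j) + Minkowski.bilin zX (u j) with hc1
  -- bounds on the constants
  have hnu_i := norm_u_le (Λ i) (hu i) (hv i)
  have hnu_j := norm_u_le (Λ j) (hu j) (hv j)
  have hOn : ‖O‖ = dist (p i) (p j) := by rw [hO, norm_ofTimeSpace_sub, dist_comm]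
  have hc2a : |Minkowski.bilin O (u i)| ≤ 2 * dist (p i) (p j) := by
    refine (abs_minkowski_bilin_le _ _).trans ?_
    rw [hOn, mul_comm]
    exact mul_le_mul_of_nonneg_right hnu_i dist_nonneg
  have hc1a : |Minkowski.bilin O (u j)| ≤ 2 * dist (p i) (p j) := by
    refine (abs_minkowski_bilin_le _ _).trans ?_
    rw [hOn, mul_comm]
    exact mul_le_mul_of_nonneg_right hnu_j dist_nonneg
  have hc2b : |Minkowski.bilin zA (u i)| ≤ 170 * M j := by
    refine (abs_minkowski_bilin_le _ _).trans ?_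
    calc ‖zA‖ * ‖u i‖ ≤ 85 * M j * 2 := mul_le_mul hzAn hnu_i (norm_nonneg _) (by positivity)
      _ = 170 * M j := by ring
  have hc1b : |Minkowski.bilin zX (u j)| ≤ 170 * M i := by
    refine (abs_minkowski_bilin_le _ _).trans ?_
    calc ‖zX‖ * ‖u j‖ ≤ 85 * M i * 2 := mul_le_mul hzXn hnu_j (norm_nonneg _) (by positivity)
      _ = 170 * M i := by ring
  have hC2 : |c2| ≤ K := by
    have h1 := abs_le.mp hc2a
    have h2 := abs_le.mp hc2b
    rw [abs_le]
    constructor <;> linarith [h1.1, h1.2, h2.1, h2.2]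
  have hC1 : |c1| ≤ K := by
    have h1 := abs_le.mp hc1a
    have h2 := abs_le.mp hc1b
    rw [abs_le]
    constructor <;> linarith [h1.1, h1.2, h2.1, h2.2]
  -- `γ ≤ 4`
  have hγle : γ ≤ 4 := by
    have h1 := abs_minkowski_bilin_le (u j) (u i)
    have h2 : ‖u j‖ * ‖u i‖ ≤ 2 * 2 := mul_le_mul hnu_j hnu_i (norm_nonneg _) (by norm_num)
    have h3 := (abs_le.mp (h1.trans h2)).1
    rw [hγdef]
    linarith
  -- `τ_X ≥ −85 Mᵢ`, `τ_A ≥ 22K/(γ − 1)`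
  have hui1 := one_le_u_zero (Λ i) (hu i) (hv i).1
  have hujle := u_zero_le (Λ j) (hu j) (hv j)
  have hzX0' := (abs_le.mp hzX0)
  have hzA0' := (abs_le.mp hzA0)
  have hτX_lo : -(85 * M i) ≤ τX := by
    by_contra hlt
    push Not at hlt
    have hneg : τX ≤ 0 := by linarith
    have h1 : τX * u i 0 ≤ τX * 1 := mul_le_mul_of_nonpos_left hui1 hneg
    linarith [hzX0'.1, hzX0'.2]
  have hWpos : 0 < 22 * K / (γ - 1) := by
    have : 0 < γ - 1 := by linarith
    positivity
  have hτA_lo : 22 * K / (γ - 1) ≤ τA := by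
    have h1 : 51 / 50 * (22 * K / (γ - 1)) ≤ τA * u j 0 := by linarith [hzA0'.1, hzA0'.2]
    have hτApos : 0 < τA := by
      by_contra hle
      push Not at hle
      have : τA * u j 0 ≤ 0 := mul_nonpos_of_nonpos_of_nonneg hle (hv j).1.le
      linarith
    have h2 : τA * u j 0 ≤ τA * (51 / 50) := mul_le_mul_of_nonneg_left hujle hτApos.le
    linarith
  have h22 : 22 * K ≤ (γ - 1) * τA := by
    have := (div_le_iff₀ (by linarith : 0 < γ - 1)).mp hτA_lo
    linarith
  have h255 : 255 * M i ≤ K := by rw [hK]; linarith [dist_nonneg (x := p i) (y := p j)]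
  have hcore := leg_core hγ hγle hKpos h255 hC1 hC2 hτX_lo h22
  -- `Eⱼ R₂ = Eᵢ R₁`, `R₂ = λ Eᵢ > 0`
  have hR2pos : 0 < γ * τA - τX + c2 := by rw [← hR2, hki]; positivity
  have hcross : Ej * (γ * τA - τX + c2) = Ei * (τA - γ * τX + c1) := by
    rw [← hR2, ← hR1, hki, hkj]; ring
  have hγpos : 0 < γ := by linarith
  rw [← sub_nonneg]
  have hγne : γ ≠ 0 := hγpos.ne'
  have hkey : 0 ≤ ((1 + γ) / (2 * γ) * Ei - Ej) * (γ * τA - τX + c2) := by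
    have e1 : ((1 + γ) / (2 * γ) * Ei - Ej) * (γ * τA - τX + c2) =
        Ei * (((1 + γ) * (γ * τA - τX + c2) - 2 * γ * (τA - γ * τX + c1)) / (2 * γ)) := by
      rw [sub_mul, hcross]
      field_simp
    rw [e1]
    exact mul_nonneg hEi.le (div_nonneg (by linarith) (by linarith))
  exact nonneg_of_mul_nonneg_left hkey hR2pos

end Leg

end Summit.FinalStateConjecture.FinalStateConjecture.Theorems.RecedingDoppler

end
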